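import Literature.MathematicalPhysics.QuantumFieldTheory.Balaban1983to89.B12ContinuousTransportInvarianceOn
import Literature.MathematicalPhysics.QuantumFieldTheory.Balaban1983to89.T3UnitLawDensityEML
import Mathlib.Probability.Kernel.Disintegration.Unique
import HarnessLib

/-!
# Crux `FluctuationComparisonRegPrIntL` (stmt-QuantumFields-20520, rung R3), PATH-B package `Lines/runpair_organ.lean` v16, LINE g25-1
# «organ_tangent» v2.2, row VER∘ `FibreMeanVersionCan` — TOOLS for the re-cut «VER∘ ⟸ regular small-field disintegration of `descend`»

LEAD-20520 width seat ym-ust-20520-w3 g22 (cell ym3-torus), `--supports stmt-QuantumFields-20520` (helper).  THEOREMS ONLY, def-free,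
[folklore] measure theory ∕ topology over Mathlib and the tree:

* §1 DISINTEGRATIONS IN `bind` FORM.  For a finite measure `m` on `Y`, a measurable `d : Y → X` and a Markov kernel `σ : X ⇝ Y` with
  `(m.map d).bind σ = m` and fibres carried a.e. (`∀ᵐ V ∂(m.map d), ∀ᵐ U ∂(σ V), d U = V` — the shape of ✓`FibreLaplace.stub_descentDisintegration`
  and of the σ-binders of VER∘∕LIN∘∕JEN∘): `(m.map d) ⊗ₘ σ = m.map (U ↦ (d U, U))` (`compProd_eq_map_graph_of_bind`), hence on a standard Borel
  `Y` ANY TWO such kernels agree `(m.map d)`-a.e. (`ae_eq_of_bind_of_bind`, Mathlib `eq_condKernel_of_measure_eq_compProd`).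
* §2 TRANSFER OF NULL SETS THROUGH A DENSITY IDENTITY.  If `(m.withDensity ρY).map d = μX.withDensity ρX` then every `(m.map d)`-a.e.
  statement holds `μX`-a.e. ON `{ρX ≠ 0}` (`ae_on_of_ae_map_of_withDensity_eq`) — the mechanism by which O1's frame (tower consistency
  `μ_j = descend_* μ_{j+1}`, densities, `ρ_j > 0` on the window) turns «`descend_* dU_{j+1}`-a.e.» into «`dU_j`-a.e. on the window» with NO
  measure-class hypothesis on `descend`.
* §3 LOCALISED PRODUCTS ARE GLOBALLY CONTINUOUS.  `χ·g` is continuous on the whole space when `χ` is continuous with `tsupport χ ⊆ O`, `O`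
  open, `g` continuous on `O` (Mathlib `ContinuousOn.continuous_of_tsupport_subset`); `tsupport` from a pointwise support bound.
* §4 THE SMALL-FIELD CUTOFF TERM of «organ_tangent» v2.1∕v2.2 (`sfCut θ U = ∏_p max 0 (min 1 (3 − 4·dist1(U(∂p))∕θ))`, stated here on the
  TERM, no `def`): continuous, valued in `[0,1]`, `= 1` on `{PlaqSmall (θ∕2)}`, `≠ 0 ⇒ PlaqSmall (3θ∕4)` and `> 0` on `{PlaqSmall (3θ∕4)}` (for `θ > 0`); the closed shell
  `{∀ p, dist1 ≤ c}` and `closure {PlaqSmall c} ⊆ {∀ p, dist1 ≤ c} ⊆ {PlaqSmall θ}` for `c < θ`.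
* §5 `absolutelyContinuous_map_descend`: `descend_* dU_{K+1} ≪ dU_K` (tree `HaarAC` for the (0.4) averaging + the measure-preserving level
  identification).

HONEST FRAMING: plumbing for ONE row of ONE line of the PATH-B package; nothing of Bałaban's is asserted or proved; VER∘, LIN∘, JEN∘, O1,
crux 20520, `YM3TorusSU2` are NOT proved; the registry `Lines/semiclassical_s2beta.lean` v11.4 (★★OWNER RULING №36) is untouched; rung R3 =
SU(2) YM₃ on T³ — NOT d = 4, NOT infinite volume, NOT a mass gap, NOT Clay; the Yang–Mills mass gap is NOT proved by any of this.
-/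

set_option autoImplicit false

noncomputable section

namespace Summit.QuantumFields.YangMills.Theorems.OrganTangentFibreMeanTools

open MeasureTheory ProbabilityTheory Filter Topology Set
open scoped ENNReal
open Literature.MathematicalPhysics.QuantumFieldTheory.Balaban1983to89
open Literature.MathematicalPhysics.QuantumFieldTheory.Balaban1983to89.B12ContinuousTransportInvarianceOn
  (continuous_dist1_SU continuous_plaqHol_SU)

/-! ## §1 Disintegrations in `bind` form: the `compProd` identity and a.e. uniqueness -/

section Disintegration

variable {X Y : Type*} [MeasurableSpace X] [MeasurableSpace Y]

/-- **`bind` + fibre clause ⇒ `compProd` form.**  If `(m.map d).bind σ = m` and `σ_V` is carried by the fibre `{d = V}` for `(m.map d)`-a.e.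
`V`, then `(m.map d) ⊗ₘ σ` is the joint law of `(d U, U)` under `m`. [folklore] -/
theorem compProd_eq_map_graph_of_bind (m : Measure Y) [IsFiniteMeasure m] {d : Y → X} (hd : Measurable d)
    (σ : Kernel X Y) [IsMarkovKernel σ] (hbind : (m.map d).bind ⇑σ = m)
    (hfib : ∀ᵐ V ∂(m.map d), ∀ᵐ U ∂(σ V), d U = V) :
    (m.map d) ⊗ₘ σ = m.map (fun U => (d U, U)) := by
  have hg : Measurable (fun U : Y => (d U, U)) := hd.prodMk measurable_id
  ext s hs
  rw [Measure.compProd_apply hs, Measure.map_apply hg hs]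
  conv_rhs => rw [← hbind]
  rw [Measure.bind_apply (hg hs) σ.measurable.aemeasurable]
  refine lintegral_congr_ae ?_
  filter_upwards [hfib] with V hV
  refine measure_congr ?_
  filter_upwards [hV] with U hU
  show (U ∈ Prod.mk V ⁻¹' s) = (U ∈ (fun U : Y => (d U, U)) ⁻¹' s)
  rw [Set.mem_preimage, Set.mem_preimage, hU]

/-- **Two disintegrations of one measure along one map agree almost everywhere** (standard Borel fibre space): if `σ` and `σ₀` both
satisfy the `bind` identity and the fibre clause for `m` along `d`, then `σ V = σ₀ V` for `(m.map d)`-a.e. `V`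
(Mathlib `eq_condKernel_of_measure_eq_compProd`, applied twice to the joint law of `(d U, U)`). [folklore] -/
theorem ae_eq_of_bind_of_bind [StandardBorelSpace Y] [Nonempty Y] (m : Measure Y) [IsFiniteMeasure m] {d : Y → X}
    (hd : Measurable d) (σ σ₀ : Kernel X Y) [IsMarkovKernel σ] [IsMarkovKernel σ₀]
    (hbind : (m.map d).bind ⇑σ = m) (hfib : ∀ᵐ V ∂(m.map d), ∀ᵐ U ∂(σ V), d U = V)
    (hbind₀ : (m.map d).bind ⇑σ₀ = m) (hfib₀ : ∀ᵐ V ∂(m.map d), ∀ᵐ U ∂(σ₀ V), d U = V) :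
    ∀ᵐ V ∂(m.map d), σ V = σ₀ V := by
  have hg : Measurable (fun U : Y => (d U, U)) := hd.prodMk measurable_id
  set ρ : Measure (X × Y) := m.map (fun U => (d U, U)) with hρ
  haveI : IsFiniteMeasure ρ := Measure.isFiniteMeasure_map m _
  have hfst : ρ.fst = m.map d := by
    rw [Measure.fst, hρ, Measure.map_map measurable_fst hg]
    rfl
  have h1 : ρ = ρ.fst ⊗ₘ σ := by rw [hfst, compProd_eq_map_graph_of_bind m hd σ hbind hfib]
  have h2 : ρ = ρ.fst ⊗ₘ σ₀ := by rw [hfst, compProd_eq_map_graph_of_bind m hd σ₀ hbind₀ hfib₀]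
  have e1 := eq_condKernel_of_measure_eq_compProd σ h1
  have e2 := eq_condKernel_of_measure_eq_compProd σ₀ h2
  rw [hfst] at e1 e2
  filter_upwards [e1, e2] with V h1V h2V
  rw [h1V, h2V]

end Disintegration

/-! ## §2 Transfer of null sets through a density identity -/

section Transfer

variable {X Y : Type*} [MeasurableSpace X] [MeasurableSpace Y]

/-- **TRANSFER OF a.e. STATEMENTS THROUGH `(ρY·m).map d = ρX·μX`.**  If the push-forward of the density measure `m.withDensity ρY` under `d`
is `μX.withDensity ρX`, then a `(m.map d)`-null set meets `{ρX ≠ 0}` in a `μX`-null set; so every `(m.map d)`-a.e. statement holds `μX`-a.e.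
on any `W ⊆ {ρX ≠ 0}`.  (O1's frame: `m = dU_{j+1}`, `μX = dU_j`, `ρY = ρ_{j+1}`, `ρX = ρ_j > 0` on the window.) [folklore] -/
theorem ae_on_of_ae_map_of_withDensity_eq (m : Measure Y) {d : Y → X} (hd : Measurable d) (μX : Measure X)
    (ρY : Y → ℝ≥0∞) {ρX : X → ℝ≥0∞} (hρX : AEMeasurable ρX μX)
    (hcons : (m.withDensity ρY).map d = μX.withDensity ρX) {W : Set X} (hW : ∀ V ∈ W, ρX V ≠ 0)
    {p : X → Prop} (h : ∀ᵐ V ∂(m.map d), p V) : ∀ᵐ V ∂μX, V ∈ W → p V := by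
  rw [ae_iff] at h
  obtain ⟨A, hNA, hA, hA0⟩ := exists_measurable_superset_of_null h
  have h1 : m (d ⁻¹' A) = 0 := by rwa [Measure.map_apply hd hA] at hA0
  have h2 : (m.withDensity ρY) (d ⁻¹' A) = 0 := withDensity_absolutelyContinuous m ρY h1
  have h3 : μX.withDensity ρX A = 0 := by rw [← hcons, Measure.map_apply hd hA]; exact h2
  rw [withDensity_apply _ hA, lintegral_eq_zero_iff' hρX.restrict] at h3
  have h4 : ∀ᵐ V ∂μX, V ∈ A → ρX V = 0 := (ae_restrict_iff' hA).mp h3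
  rw [ae_iff] at h4 ⊢
  refine measure_mono_null (fun V hV => ?_) h4
  simp only [Classical.not_imp, Set.mem_setOf_eq] at hV ⊢
  exact ⟨hNA hV.2, hW V hV.1⟩

end Transfer

/-! ## §3 Localised products are globally continuous; continuous functions on compact spaces are integrable -/

section Localise

variable {Z : Type*} [TopologicalSpace Z]

/-- The topological support of a function is inside any CLOSED set containing its support. [folklore] -/
theorem tsupport_subset_of_closed {χ : Z → ℝ} {C : Set Z} (hC : IsClosed C) (h : ∀ U, χ U ≠ 0 → U ∈ C) :
    tsupport χ ⊆ C :=
  closure_minimal (fun U hU => h U (Function.mem_support.mp hU)) hC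

/-- **`χ · g` is continuous everywhere** when `χ` is continuous with `tsupport χ ⊆ O`, `O` open, and `g` is continuous ON `O` (whatever `g`
does off `O`). [folklore] -/
theorem continuous_mul_of_tsupport_subset {χ g : Z → ℝ} {O : Set Z} (hO : IsOpen O) (hχ : Continuous χ)
    (hsupp : tsupport χ ⊆ O) (hg : ContinuousOn g O) : Continuous fun U => χ U * g U :=
  ContinuousOn.continuous_of_tsupport_subset (hχ.continuousOn.mul hg) hO
    ((tsupport_mul_subset_left (f := χ) (g := g)).trans hsupp)

/-- A localised function vanishes off the localising set: `tsupport χ ⊆ O`, `U ∉ O` ⇒ `χ U * g U = 0`. [folklore] -/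
theorem mul_eq_zero_of_notMem {χ g : Z → ℝ} {O : Set Z} (hsupp : tsupport χ ⊆ O) {U : Z} (hU : U ∉ O) :
    χ U * g U = 0 := by
  have : χ U = 0 := by
    by_contra h
    exact hU (hsupp (subset_tsupport χ (Function.mem_support.mpr h)))
  rw [this, zero_mul]

/-- On a compact space every continuous real function is integrable against every finite measure. [folklore] -/
theorem integrable_of_continuous_compact [CompactSpace Z] [MeasurableSpace Z] [OpensMeasurableSpace Z]
    {f : Z → ℝ} (hf : Continuous f) (μ : Measure Z) [IsFiniteMeasure μ] : Integrable f μ :=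
  hf.integrable_of_hasCompactSupport (HasCompactSupport.of_compactSpace f)

end Localise

/-! ## §4 The small-field cutoff term of «organ_tangent» and the shells of the window (`G = SU(2)`) -/

section SfCut

variable {P : Params} {k : ℕ}

/-- `U ↦ dist1 (U(∂p))` is continuous on `SU(2)`-fields. [folklore] -/
theorem continuous_dist1_plaqHol (p : Plaq P k) :
    Continuous fun U : GaugeField P k ↥(Matrix.specialUnitaryGroup (Fin 2) ℂ) => dist1 (GaugeField.plaqHol U p) :=
  (continuous_dist1_SU (N := 2)).comp (continuous_plaqHol_SU p)

/-- **The cutoff term is continuous.** [folklore] -/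
theorem continuous_sfCutTerm (θ : ℝ) :
    Continuous fun U : GaugeField P k ↥(Matrix.specialUnitaryGroup (Fin 2) ℂ) =>
      ∏ p : Plaq P k, max 0 (min 1 (3 - 4 * dist1 (GaugeField.plaqHol U p) / θ)) :=
  continuous_finsetProd _ fun p _ =>
    continuous_const.max (continuous_const.min (continuous_const.sub
      ((continuous_const.mul (continuous_dist1_plaqHol p)).div_const θ)))

/-- The cutoff term is non-negative. [folklore] -/
theorem sfCutTerm_nonneg (θ : ℝ) (U : GaugeField P k ↥(Matrix.specialUnitaryGroup (Fin 2) ℂ)) :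
    0 ≤ ∏ p : Plaq P k, max 0 (min 1 (3 - 4 * dist1 (GaugeField.plaqHol U p) / θ)) :=
  Finset.prod_nonneg fun _ _ => le_max_left _ _

/-- The cutoff term is at most `1`. [folklore] -/
theorem sfCutTerm_le_one (θ : ℝ) (U : GaugeField P k ↥(Matrix.specialUnitaryGroup (Fin 2) ℂ)) :
    ∏ p : Plaq P k, max 0 (min 1 (3 - 4 * dist1 (GaugeField.plaqHol U p) / θ)) ≤ 1 :=
  Finset.prod_le_one (fun _ _ => le_max_left _ _) fun _ _ => max_le zero_le_one (min_le_left _ _)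

/-- **The cutoff term equals `1` on the half-window** `{PlaqSmall (θ∕2)}` (`θ > 0`). [folklore] -/
theorem sfCutTerm_eq_one_of_plaqSmall_half {θ : ℝ} (hθ : 0 < θ) (U : GaugeField P k ↥(Matrix.specialUnitaryGroup (Fin 2) ℂ))
    (hU : PlaqSmall (θ / 2) U) :
    ∏ p : Plaq P k, max 0 (min 1 (3 - 4 * dist1 (GaugeField.plaqHol U p) / θ)) = 1 := by
  refine Finset.prod_eq_one fun p _ => ?_
  have hp : dist1 (GaugeField.plaqHol U p) < θ / 2 := hU p
  have h1 : 4 * dist1 (GaugeField.plaqHol U p) / θ ≤ 2 := by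
    rw [div_le_iff₀ hθ]; linarith
  rw [min_eq_left (by linarith), max_eq_right zero_le_one]

/-- **Where the cutoff term is non-zero the field is in the `¾`-window** `{PlaqSmall (3θ∕4)}` (`θ > 0`): one plaquette with
`dist1 ≥ ¾θ` kills its factor. [folklore] -/
theorem plaqSmall_of_sfCutTerm_ne_zero {θ : ℝ} (hθ : 0 < θ) (U : GaugeField P k ↥(Matrix.specialUnitaryGroup (Fin 2) ℂ))
    (hU : ∏ p : Plaq P k, max 0 (min 1 (3 - 4 * dist1 (GaugeField.plaqHol U p) / θ)) ≠ 0) :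
    PlaqSmall (3 / 4 * θ) U := by
  intro p
  by_contra hp
  push Not at hp
  apply hU
  refine Finset.prod_eq_zero (Finset.mem_univ p) ?_
  have h1 : 3 ≤ 4 * dist1 (GaugeField.plaqHol U p) / θ := by
    rw [le_div_iff₀ hθ]; linarith
  exact max_eq_left (min_le_of_right_le (by linarith))

/-- **The cutoff term is positive on the `¾`-window** `{PlaqSmall (3θ∕4)}` (`θ > 0`): every factor is positive there. [folklore] -/
theorem sfCutTerm_pos_of_plaqSmall {θ : ℝ} (hθ : 0 < θ) (U : GaugeField P k ↥(Matrix.specialUnitaryGroup (Fin 2) ℂ))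
    (hU : PlaqSmall (3 / 4 * θ) U) :
    0 < ∏ p : Plaq P k, max 0 (min 1 (3 - 4 * dist1 (GaugeField.plaqHol U p) / θ)) := by
  refine Finset.prod_pos fun p _ => ?_
  have hp : dist1 (GaugeField.plaqHol U p) < 3 / 4 * θ := hU p
  have h1 : 4 * dist1 (GaugeField.plaqHol U p) / θ < 3 := by
    rw [div_lt_iff₀ hθ]; linarith
  exact lt_max_of_lt_right (lt_min one_pos (by linarith))

/-- The shell `{U | ∀ p, dist1 (U(∂p)) ≤ c}` is closed. [folklore] -/
theorem isClosed_setOf_dist1_le (c : ℝ) :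
    IsClosed {U : GaugeField P k ↥(Matrix.specialUnitaryGroup (Fin 2) ℂ) | ∀ p, dist1 (GaugeField.plaqHol U p) ≤ c} := by
  have : {U : GaugeField P k ↥(Matrix.specialUnitaryGroup (Fin 2) ℂ) | ∀ p, dist1 (GaugeField.plaqHol U p) ≤ c} =
      ⋂ p : Plaq P k, {U | dist1 (GaugeField.plaqHol U p) ≤ c} := by
    ext U; simp only [Set.mem_setOf_eq, Set.mem_iInter]
  rw [this]
  exact isClosed_iInter fun p => isClosed_le (continuous_dist1_plaqHol p) continuous_const

/-- A function supported in `{PlaqSmall c}` has topological support in the closed shell `{∀ p, dist1 ≤ c}`, hence in every larger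
OPEN window `{PlaqSmall θ}`, `c < θ`. [folklore] -/
theorem tsupport_subset_plaqSmall {χ : GaugeField P k ↥(Matrix.specialUnitaryGroup (Fin 2) ℂ) → ℝ} {c θ : ℝ} (hcθ : c < θ)
    (h : ∀ U, χ U ≠ 0 → PlaqSmall c U) :
    tsupport χ ⊆ {U | PlaqSmall θ U} := by
  refine (tsupport_subset_of_closed (isClosed_setOf_dist1_le c) fun U hU p => (h U hU p).le).trans ?_
  intro U hU p
  exact (hU p).trans_lt hcθ

end SfCut

/-! ## §5 The one-step descent pushes product Haar to an absolutely continuous measure (`HaarAC` + the level identification) -/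

section Descend

open T3ContinuumYM3Torus T3NestedUnitLaws T3UnitLawDensityEML T3LevelShift

/-- **`descend_* dU_{K+1} ≪ dU_K`**: Bałaban's one-step descent `descend = fieldShift ∘ blockAvg(ℰp)` pushes the product Haar measure of the finer run to a
measure absolutely continuous with respect to the product Haar measure of the coarser run (tree `T3UnitLawDensityEML.haarAC_blockAvg` for the (0.4)
averaging with the printed exp-mean-log average, and `T3LevelShift.measurePreserving_fieldShift` for the level identification). [cite: Balaban1985Averaging, (10) p.19] -/
theorem absolutelyContinuous_map_descend (F : T3Family) (K : ℕ) :
    (fieldMeasure (F.P (K + 1)) 0 ↥(Matrix.specialUnitaryGroup (Fin 2) ℂ)).map (descend F ℰp K) ≪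
      fieldMeasure (F.P K) 0 ↥(Matrix.specialUnitaryGroup (Fin 2) ℂ) := by
  have hac := haarAC_blockAvg F (K + 1) (j := 0) (by omega)
  have havg : Measurable (BlockAveraging.blockAvg (P := F.P (K + 1)) (j := 0) ℰp).avg := measurable_blockAvg F (K + 1) 0
  have hmp := measurePreserving_fieldShift (G := ↥(Matrix.specialUnitaryGroup (Fin 2) ℂ)) (sitesPerDir_descend F K 0)
  have hd : Measurable (descend F ℰp K : GaugeField (F.P (K + 1)) 0 ↥(Matrix.specialUnitaryGroup (Fin 2) ℂ) →
      GaugeField (F.P K) 0 ↥(Matrix.specialUnitaryGroup (Fin 2) ℂ)) := measurable_descend F ℰp measurableE_ℰp K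
  refine Measure.AbsolutelyContinuous.mk fun A hA hA0 => ?_
  rw [Measure.map_apply hd hA]
  have h1 : fieldMeasure (F.PP F.m (K + 1)) (0 + 1) ↥(Matrix.specialUnitaryGroup (Fin 2) ℂ)
      (fieldShift (sitesPerDir_descend F K 0) ⁻¹' A) = 0 := by
    rw [hmp.measure_preimage hA.nullMeasurableSet]; exact hA0
  have h2 := hac h1
  rw [Measure.map_apply havg (measurable_fieldShift _ hA)] at h2
  exact h2

end Descend

end Summit.QuantumFields.YangMills.Theorems.OrganTangentFibreMeanTools

end
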